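import Summits.CriticalPhenomena.PercolationContinuityZ3.Theorems.PercNearOneGluingNoHeavyQuantFarSunTKStats
import Summits.CriticalPhenomena.PercolationContinuityZ3.Theorems.PercNearOneGluingNoHeavyQuantFarSunTKCount1
import HarnessLib

/-!
# FAR beyond trees: the certificate `T_K` — ORBIT SUMS at set level: symmetry, Pascal rule, reduction, and the count-level bridge

builds on p205010 (kernel theorem, internal audit signed; external expert review pending)

Support file (`--supports stmt-CriticalPhenomena-4575`), seat `prim-cert-1` (gen 23); memo `prim-cert-1/FROM-prim-cert-1-g23-SUNFAR-ALL-K.md` §3.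
Vocabulary `…QuantFarSunTKDefs`; statistics `…QuantFarSunTKStats`.

The law-level symmetrisation leads to PAIR SUMS `Σ_{J ⊆ T} W(A ∩ (Z ∪ J), B ∩ (Z ∪ (T ∖ J)))` (arcsets `A`, `B`; sure hairs `Z`; split hairs `T`
distributed over the two copies).  This file proves:
* `TK.orbit_symm`, `TK.pairSum_symm` — symmetry under exchanging the copies (`J ↦ T ∖ J`);
* `TK.orbit_insert` — the PASCAL RULE `orbit P_A P_B (insert x T) = orbit (insert x P_A) P_B T + orbit P_A (insert x P_B) T`;
* `TK.pairSum_insert_of_not_mem` — the exact REDUCTION: a split hair outside `A ∩ B` is a sure hair of one copy or absent (memo §3(a));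
* `TK.pairSum_eq_orbit` — when `T ⊆ A ∩ B` the pair sum is `orbit (A ∩ Z) (B ∩ Z) T`;
* **`TK.orbit_eq_Gc`** — the COUNT-LEVEL BRIDGE: `orbit K P_A P_B T = Gc K c p q s e₀ e_K` with `c, p, q` the common / A-private / B-private interior
  counts, `s = |T ∩ inner|` and `e₀`, `e_K` the end states (memo §3(b)); via `TK.Wcert_eq_Wc`, peeling the two end indices and
  `Finset.sum_powerset_apply_card` on the interior splits;
* `TK.orbit_nonneg_of_two_le` — **every orbit sum with at least two interior split hairs is `≥ 0`** (Pascal rule down to `TK.gc_two_nonneg`).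
No sorries; standard axioms.  Elementary [this work].
-/

namespace Summit.CriticalPhenomena.PercolationContinuityZ3.Theorems.HairyCycle

namespace TK

open Finset

variable {K : ℕ}

/-! ## Symmetry and the Pascal rule -/

/-- `W` is symmetric. [this work] -/
theorem Wcert_comm (R R' : Finset ℕ) : Wcert K R R' = Wcert K R' R := by
  unfold Wcert; ring

/-- Reindexing `J ↦ T ∖ J` in a sum over the subsets of `T`. [this work] -/
theorem sum_powerset_sdiff (T : Finset ℕ) (f : Finset ℕ → ℤ) : ∑ J ∈ T.powerset, f (T \ J) = ∑ J ∈ T.powerset, f J := by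
  refine Finset.sum_nbij' (fun J => T \ J) (fun J => T \ J) ?_ ?_ ?_ ?_ ?_
  · intro J _; exact Finset.mem_powerset.2 Finset.sdiff_subset
  · intro J _; exact Finset.mem_powerset.2 Finset.sdiff_subset
  · intro J hJ; rw [Finset.mem_powerset] at hJ; exact Finset.sdiff_sdiff_eq_self hJ
  · intro J hJ; rw [Finset.mem_powerset] at hJ; exact Finset.sdiff_sdiff_eq_self hJ
  · intro J _; rfl

/-- The orbit sum is symmetric under exchanging the two copies. [this work] -/
theorem orbit_symm (PA PB T : Finset ℕ) : orbit K PA PB T = orbit K PB PA T := by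
  unfold orbit
  rw [← sum_powerset_sdiff T (fun J => Wcert K (PB ∪ J) (PA ∪ (T \ J)))]
  refine Finset.sum_congr rfl fun J hJ => ?_
  rw [Finset.mem_powerset] at hJ
  rw [Finset.sdiff_sdiff_eq_self hJ, Wcert_comm]

/-- **PASCAL RULE** at set level: a split hair is a sure hair of copy A or of copy B:
`orbit P_A P_B (insert x T) = orbit (insert x P_A) P_B T + orbit P_A (insert x P_B) T` (`x ∉ T`). [this work] -/
theorem orbit_insert {PA PB T : Finset ℕ} {x : ℕ} (hx : x ∉ T) :
    orbit K PA PB (insert x T) = orbit K (insert x PA) PB T + orbit K PA (insert x PB) T := by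
  unfold orbit
  rw [Finset.sum_powerset_insert hx, add_comm]
  congr 1
  · refine Finset.sum_congr rfl fun J hJ => ?_
    rw [Finset.mem_powerset] at hJ
    have hxJ : x ∉ J := fun h => hx (hJ h)
    congr 1
    · rw [Finset.insert_union, Finset.union_insert]
    · rw [Finset.insert_sdiff_insert, Finset.sdiff_insert_of_notMem hx]
  · refine Finset.sum_congr rfl fun J hJ => ?_
    rw [Finset.mem_powerset] at hJ
    have hxJ : x ∉ J := fun h => hx (hJ h)
    congr 1
    rw [Finset.insert_sdiff_of_notMem _ hxJ, Finset.union_insert, Finset.insert_union]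

/-! ## Pair sums: reduction of split hairs outside `A ∩ B` -/

/-- **EXACT REDUCTION** (memo §3(a)): a split hair `x ∉ A ∩ B` contributes as a sure hair of the pattern or as an absent one:
`Σ_{J ⊆ T+x} W(A∩(Z∪J), B∩(Z∪(T+x)∖J)) = Σ_{J ⊆ T} W(A∩((Z+x)∪J), B∩((Z+x)∪T∖J)) + Σ_{J ⊆ T} W(A∩(Z∪J), B∩(Z∪T∖J))`. [this work] -/
theorem pairSum_insert_of_not_mem {A B Z T : Finset ℕ} {x : ℕ} (hxT : x ∉ T) (hx : x ∉ A ∩ B) :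
    ∑ J ∈ (insert x T).powerset, Wcert K (A ∩ (Z ∪ J)) (B ∩ (Z ∪ (insert x T \ J))) =
      ∑ J ∈ T.powerset, Wcert K (A ∩ (insert x Z ∪ J)) (B ∩ (insert x Z ∪ (T \ J))) +
        ∑ J ∈ T.powerset, Wcert K (A ∩ (Z ∪ J)) (B ∩ (Z ∪ (T \ J))) := by
  rw [Finset.sum_powerset_insert hxT]
  rw [Finset.mem_inter, not_and_or] at hx
  have h1 : ∀ J ∈ T.powerset, insert x T \ J = insert x (T \ J) := by
    intro J hJ
    rw [Finset.mem_powerset] at hJ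
    exact Finset.insert_sdiff_of_notMem _ (fun h => hxT (hJ h))
  have h2 : ∀ J ∈ T.powerset, insert x T \ insert x J = T \ J := by
    intro J hJ
    rw [Finset.mem_powerset] at hJ
    rw [Finset.insert_sdiff_insert, Finset.sdiff_insert_of_notMem hxT]
  rcases hx with hxA | hxB
  · -- x ∉ A: owned by A = absent; owned by B = sure hair of the pattern
    congr 1
    · refine Finset.sum_congr rfl fun J hJ => ?_
      simp only [h1 J hJ, Finset.union_insert, Finset.insert_union, Finset.inter_insert_of_notMem hxA]
    · refine Finset.sum_congr rfl fun J hJ => ?_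
      simp only [h2 J hJ, Finset.union_insert, Finset.inter_insert_of_notMem hxA]
  · -- x ∉ B: owned by A = sure hair of the pattern; owned by B = absent
    rw [add_comm]
    congr 1
    · refine Finset.sum_congr rfl fun J hJ => ?_
      simp only [h2 J hJ, Finset.union_insert, Finset.insert_union, Finset.inter_insert_of_notMem hxB]
    · refine Finset.sum_congr rfl fun J hJ => ?_
      simp only [h1 J hJ, Finset.union_insert, Finset.inter_insert_of_notMem hxB]

/-- When every split hair lies in `A ∩ B`, the pair sum is the orbit sum of the forced sets `A ∩ Z`, `B ∩ Z`. [this work] -/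
theorem pairSum_eq_orbit {A B Z T : Finset ℕ} (hT : T ⊆ A ∩ B) :
    ∑ J ∈ T.powerset, Wcert K (A ∩ (Z ∪ J)) (B ∩ (Z ∪ (T \ J))) = orbit K (A ∩ Z) (B ∩ Z) T := by
  unfold orbit
  refine Finset.sum_congr rfl fun J hJ => ?_
  rw [Finset.mem_powerset] at hJ
  have hJA : J ⊆ A := fun k hk => (Finset.mem_inter.1 (hT (hJ hk))).1
  have hTB : T \ J ⊆ B := fun k hk => (Finset.mem_inter.1 (hT (Finset.mem_sdiff.1 hk).1)).2
  rw [Finset.inter_union_distrib_left, Finset.inter_eq_right.2 hJA, Finset.inter_union_distrib_left, Finset.inter_eq_right.2 hTB]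

/-- The pair sum is symmetric under exchanging the two arcsets (copies). [this work] -/
theorem pairSum_symm (A B Z T : Finset ℕ) :
    ∑ J ∈ T.powerset, Wcert K (A ∩ (Z ∪ J)) (B ∩ (Z ∪ (T \ J))) = ∑ J ∈ T.powerset, Wcert K (B ∩ (Z ∪ J)) (A ∩ (Z ∪ (T \ J))) := by
  rw [← sum_powerset_sdiff T (fun J => Wcert K (B ∩ (Z ∪ J)) (A ∩ (Z ∪ (T \ J))))]
  refine Finset.sum_congr rfl fun J hJ => ?_
  rw [Finset.mem_powerset] at hJ
  rw [Finset.sdiff_sdiff_eq_self hJ, Wcert_comm]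

/-! ## The count-level bridge -/

/-- Interior-only split hairs: the orbit sum through `Wc` and the binomial regrouping by `|J|`. [this work] -/
theorem orbit_eq_sum_choose (hK : 4 ≤ K) {P Q T : Finset ℕ} (hP : P ⊆ range K) (hQ : Q ⊆ range K) (hT : T ⊆ inner K)
    (hPT : Disjoint P T) (hQT : Disjoint Q T) :
    orbit K P Q T = ∑ j ∈ range (T.card + 1), (T.card.choose j : ℤ) *
      Wc K ((P ∩ inner K).card + j) ((Q ∩ inner K).card + (T.card - j)) (P ∩ Q ∩ inner K).card
        (decide (0 ∈ P)) (decide (K - 1 ∈ P)) (decide (0 ∈ Q)) (decide (K - 1 ∈ Q)) := by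
  classical
  unfold orbit
  have hTr : T ⊆ range K := hT.trans inner_subset_range
  have h0T : (0 : ℕ) ∉ T := fun h => by have := mem_inner.1 (hT h); omega
  have hKT : K - 1 ∉ T := fun h => by have := mem_inner.1 (hT h); omega
  have key : ∀ J ∈ T.powerset, Wcert K (P ∪ J) (Q ∪ (T \ J)) =
      Wc K ((P ∩ inner K).card + J.card) ((Q ∩ inner K).card + (T.card - J.card)) (P ∩ Q ∩ inner K).card
        (decide (0 ∈ P)) (decide (K - 1 ∈ P)) (decide (0 ∈ Q)) (decide (K - 1 ∈ Q)) := by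
    intro J hJ
    rw [Finset.mem_powerset] at hJ
    have hJi : J ⊆ inner K := hJ.trans hT
    have hTJi : T \ J ⊆ inner K := Finset.sdiff_subset.trans hT
    rw [Wcert_eq_Wc hK (Finset.union_subset hP (hJ.trans hTr)) (Finset.union_subset hQ (Finset.sdiff_subset.trans hTr))]
    -- the statistics
    have hPJ : Disjoint P J := hPT.mono_right hJ
    have hQJ : Disjoint Q (T \ J) := hQT.mono_right Finset.sdiff_subset
    have e1 : ((P ∪ J) ∩ inner K).card = (P ∩ inner K).card + J.card := by
      rw [Finset.union_inter_distrib_right, Finset.inter_eq_left.2 hJi,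
        Finset.card_union_of_disjoint (hPJ.mono_left Finset.inter_subset_left)]
    have e2 : ((Q ∪ (T \ J)) ∩ inner K).card = (Q ∩ inner K).card + (T.card - J.card) := by
      rw [Finset.union_inter_distrib_right, Finset.inter_eq_left.2 hTJi,
        Finset.card_union_of_disjoint (hQJ.mono_left Finset.inter_subset_left), Finset.card_sdiff_of_subset hJ]
    have e3 : (P ∪ J) ∩ (Q ∪ (T \ J)) ∩ inner K = P ∩ Q ∩ inner K := by
      ext k
      simp only [Finset.mem_inter, Finset.mem_union, Finset.mem_sdiff]
      constructor
      · rintro ⟨⟨hp | hj, hq | ⟨ht, hnj⟩⟩, hi⟩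
        · exact ⟨⟨hp, hq⟩, hi⟩
        · exact absurd ht (Finset.disjoint_left.1 hPT hp)
        · exact absurd (hJ hj) (Finset.disjoint_left.1 hQT hq)
        · exact absurd hj hnj
      · rintro ⟨⟨hp, hq⟩, hi⟩; exact ⟨⟨Or.inl hp, Or.inl hq⟩, hi⟩
    have f1 : (0 ∈ P ∪ J) ↔ (0 ∈ P) := by
      rw [Finset.mem_union]; exact ⟨fun h => h.elim id (fun h => absurd (hJ h) h0T), Or.inl⟩
    have f2 : (K - 1 ∈ P ∪ J) ↔ (K - 1 ∈ P) := by
      rw [Finset.mem_union]; exact ⟨fun h => h.elim id (fun h => absurd (hJ h) hKT), Or.inl⟩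
    have f3 : (0 ∈ Q ∪ (T \ J)) ↔ (0 ∈ Q) := by
      rw [Finset.mem_union]; exact ⟨fun h => h.elim id (fun h => absurd (Finset.mem_sdiff.1 h).1 h0T), Or.inl⟩
    have f4 : (K - 1 ∈ Q ∪ (T \ J)) ↔ (K - 1 ∈ Q) := by
      rw [Finset.mem_union]; exact ⟨fun h => h.elim id (fun h => absurd (Finset.mem_sdiff.1 h).1 hKT), Or.inl⟩
    rw [e1, e2, e3]
    simp only [f1, f2, f3, f4]
  rw [Finset.sum_congr rfl key]
  rw [Finset.sum_powerset_apply_card (fun n => Wc K ((P ∩ inner K).card + n) ((Q ∩ inner K).card + (T.card - n))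
    (P ∩ Q ∩ inner K).card (decide (0 ∈ P)) (decide (K - 1 ∈ P)) (decide (0 ∈ Q)) (decide (K - 1 ∈ Q)))]
  simp only [nsmul_eq_mul]

/-- `0` is not interior. [this work] -/
theorem zero_not_mem_inner : (0 : ℕ) ∉ inner K := fun h => (mem_inner.1 h).2.1 rfl

/-- `K − 1` is not interior. [this work] -/
theorem last_not_mem_inner : K - 1 ∉ inner K := fun h => (mem_inner.1 h).2.2 rfl

/-- `|P ∩ inner| = |P ∩ Q ∩ inner| + |(P ∖ Q) ∩ inner|`. [this work] -/
theorem card_inter_inner_split (P Q : Finset ℕ) :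
    (P ∩ inner K).card = (P ∩ Q ∩ inner K).card + ((P \ Q) ∩ inner K).card := by
  classical
  rw [← Finset.card_union_of_disjoint]
  · congr 1; ext k; simp only [Finset.mem_inter, Finset.mem_union, Finset.mem_sdiff]; tauto
  · rw [Finset.disjoint_left]; intro k h1 h2
    simp only [Finset.mem_inter, Finset.mem_sdiff] at h1 h2; exact h2.1.2 h1.1.2

/-- `|Q ∩ inner| = |P ∩ Q ∩ inner| + |(Q ∖ P) ∩ inner|`. [this work] -/
theorem card_inter_inner_split' (P Q : Finset ℕ) :
    (Q ∩ inner K).card = (P ∩ Q ∩ inner K).card + ((Q \ P) ∩ inner K).card := by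
  rw [card_inter_inner_split Q P, Finset.inter_comm Q P]

set_option maxHeartbeats 4000000 in
set_option linter.unusedSimpArgs false in
/-- **THE COUNT-LEVEL BRIDGE** (memo §3(b)): for forced sets `P_A, P_B ⊆ range K` and split hairs `T ⊆ range K` disjoint from them,
`orbit K P_A P_B T = Gc K c p q s e₀ e_K` with `c = |P_A ∩ P_B ∩ inner|`, `p = |(P_A ∖ P_B) ∩ inner|`, `q = |(P_B ∖ P_A) ∩ inner|`, `s = |T ∩ inner|`
and the end states read off the memberships of `0` and `K − 1`. [this work] -/
theorem orbit_eq_Gc (hK : 4 ≤ K) {PA PB T : Finset ℕ} (hA : PA ⊆ range K) (hB : PB ⊆ range K) (hT : T ⊆ range K)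
    (hAT : Disjoint PA T) (hBT : Disjoint PB T) :
    orbit K PA PB T = Gc K (PA ∩ PB ∩ inner K).card ((PA \ PB) ∩ inner K).card ((PB \ PA) ∩ inner K).card (T ∩ inner K).card
      (if 0 ∈ T then ESt.s else if 0 ∈ PA then (if 0 ∈ PB then ESt.c else ESt.p) else (if 0 ∈ PB then ESt.q else ESt.n))
      (if K - 1 ∈ T then ESt.s else if K - 1 ∈ PA then (if K - 1 ∈ PB then ESt.c else ESt.p) else (if K - 1 ∈ PB then ESt.q else ESt.n)) := by
  classical
  have h0K : (0 : ℕ) ≠ K - 1 := by omega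
  set TI := T ∩ inner K with hTI
  have hTIi : TI ⊆ inner K := Finset.inter_subset_right
  have h0TI : (0 : ℕ) ∉ TI := fun h => zero_not_mem_inner (hTIi h)
  have hKTI : K - 1 ∉ TI := fun h => last_not_mem_inner (hTIi h)
  have hATI : Disjoint PA TI := hAT.mono_right Finset.inter_subset_left
  have hBTI : Disjoint PB TI := hBT.mono_right Finset.inter_subset_left
  -- T = its ends + TI
  have hTeq : T = (T.filter fun k => k = 0 ∨ k = K - 1) ∪ TI := by
    ext k; rw [Finset.mem_union, Finset.mem_filter, hTI, Finset.mem_inter, mem_inner]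
    constructor
    · intro hk; have := Finset.mem_range.1 (hT hk); by_cases h0 : k = 0; · exact Or.inl ⟨hk, Or.inl h0⟩
      by_cases h1 : k = K - 1; · exact Or.inl ⟨hk, Or.inr h1⟩
      exact Or.inr ⟨hk, this, h0, h1⟩
    · rintro (⟨hk, -⟩ | ⟨hk, -⟩) <;> exact hk
  have hcA := card_inter_inner_split (K := K) PA PB
  have hcB := card_inter_inner_split' (K := K) PA PB
  -- insertion of an end does not change interior statistics
  have iA0 : insert 0 PA ∩ inner K = PA ∩ inner K := Finset.insert_inter_of_notMem zero_not_mem_inner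
  have iB0 : insert 0 PB ∩ inner K = PB ∩ inner K := Finset.insert_inter_of_notMem zero_not_mem_inner
  have iAK : insert (K - 1) PA ∩ inner K = PA ∩ inner K := Finset.insert_inter_of_notMem last_not_mem_inner
  have iBK : insert (K - 1) PB ∩ inner K = PB ∩ inner K := Finset.insert_inter_of_notMem last_not_mem_inner
  have iAK0 : insert (K - 1) (insert 0 PA) ∩ inner K = PA ∩ inner K := by rw [Finset.insert_inter_of_notMem last_not_mem_inner, iA0]
  have iBK0 : insert (K - 1) (insert 0 PB) ∩ inner K = PB ∩ inner K := by rw [Finset.insert_inter_of_notMem last_not_mem_inner, iB0]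
  -- common interior part unchanged by end insertions
  have cmn : ∀ (P Q : Finset ℕ), P ∩ inner K = PA ∩ inner K → Q ∩ inner K = PB ∩ inner K → P ∩ Q ∩ inner K = PA ∩ PB ∩ inner K := by
    intro P Q hP hQ
    have e1 : P ∩ Q ∩ inner K = (P ∩ inner K) ∩ (Q ∩ inner K) := by
      ext k; simp only [Finset.mem_inter]; tauto
    have e2 : PA ∩ PB ∩ inner K = (PA ∩ inner K) ∩ (PB ∩ inner K) := by
      ext k; simp only [Finset.mem_inter]; tauto
    rw [e1, e2, hP, hQ]
  have rA0 : insert 0 PA ⊆ range K := Finset.insert_subset (by rw [Finset.mem_range]; omega) hA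
  have rB0 : insert 0 PB ⊆ range K := Finset.insert_subset (by rw [Finset.mem_range]; omega) hB
  have rAK : insert (K - 1) PA ⊆ range K := Finset.insert_subset (by rw [Finset.mem_range]; omega) hA
  have rBK : insert (K - 1) PB ⊆ range K := Finset.insert_subset (by rw [Finset.mem_range]; omega) hB
  have rAK0 : insert (K - 1) (insert 0 PA) ⊆ range K := Finset.insert_subset (by rw [Finset.mem_range]; omega) rA0
  have rBK0 : insert (K - 1) (insert 0 PB) ⊆ range K := Finset.insert_subset (by rw [Finset.mem_range]; omega) rB0
  have dA0 : Disjoint (insert 0 PA) TI := Finset.disjoint_insert_left.2 ⟨h0TI, hATI⟩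
  have dB0 : Disjoint (insert 0 PB) TI := Finset.disjoint_insert_left.2 ⟨h0TI, hBTI⟩
  have dAK : Disjoint (insert (K - 1) PA) TI := Finset.disjoint_insert_left.2 ⟨hKTI, hATI⟩
  have dBK : Disjoint (insert (K - 1) PB) TI := Finset.disjoint_insert_left.2 ⟨hKTI, hBTI⟩
  have dAK0 : Disjoint (insert (K - 1) (insert 0 PA)) TI := Finset.disjoint_insert_left.2 ⟨hKTI, dA0⟩
  have dBK0 : Disjoint (insert (K - 1) (insert 0 PB)) TI := Finset.disjoint_insert_left.2 ⟨hKTI, dB0⟩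
  -- membership of `k` in `T` via the ends and `TI`
  have memT : ∀ k, k ∈ T ↔ (k = 0 ∧ 0 ∈ T) ∨ (k = K - 1 ∧ K - 1 ∈ T) ∨ k ∈ TI := by
    intro k
    rw [hTI, Finset.mem_inter, mem_inner]
    constructor
    · intro hk
      have := Finset.mem_range.1 (hT hk)
      by_cases h0 : k = 0
      · subst h0; exact Or.inl ⟨rfl, hk⟩
      by_cases h1 : k = K - 1
      · subst h1; exact Or.inr (Or.inl ⟨rfl, hk⟩)
      exact Or.inr (Or.inr ⟨hk, this, h0, h1⟩)
    · rintro (⟨rfl, h⟩ | ⟨rfl, h⟩ | ⟨h, -⟩) <;> exact h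
  by_cases h0T : 0 ∈ T <;> by_cases hKT : K - 1 ∈ T
  · -- both ends split
    have h0A : (0 : ℕ) ∉ PA := fun h => Finset.disjoint_left.1 hAT h h0T
    have h0B : (0 : ℕ) ∉ PB := fun h => Finset.disjoint_left.1 hBT h h0T
    have hKA : K - 1 ∉ PA := fun h => Finset.disjoint_left.1 hAT h hKT
    have hKB : K - 1 ∉ PB := fun h => Finset.disjoint_left.1 hBT h hKT
    have hTd : T = insert 0 (insert (K - 1) TI) := by
      ext k; rw [memT, Finset.mem_insert, Finset.mem_insert]; simp only [h0T, hKT, and_true]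
    have hn0 : (0 : ℕ) ∉ insert (K - 1) TI := by rw [Finset.mem_insert]; exact fun h => h.elim h0K h0TI
    simp only [h0T, hKT, if_true]
    rw [hTd, orbit_insert hn0, orbit_insert hKTI, orbit_insert hKTI,
      orbit_eq_sum_choose hK rAK0 hB hTIi dAK0 hBTI, orbit_eq_sum_choose hK rA0 rBK hTIi dA0 dBK,
      orbit_eq_sum_choose hK rAK rB0 hTIi dAK dB0, orbit_eq_sum_choose hK hA rBK0 hTIi hATI dBK0,
      cmn _ _ iAK0 rfl, cmn _ _ iA0 iBK, cmn _ _ iAK iB0, cmn _ _ rfl iBK0, iAK0, iA0, iAK, iBK0, iBK, iB0, hcA, hcB]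
    simp only [Gc, endSum, endTerms, List.map_cons, List.map_nil, List.sum_cons, List.sum_nil, add_zero, Finset.mem_insert,
        h0A, h0B, hKA, hKB, h0K, h0K.symm, true_or, or_true, or_false, false_or, decide_true, decide_false, if_true, if_false,
        mul_add, Finset.sum_add_distrib]
  · -- end `0` split, end `K-1` decided by the forced sets
    have h0A : (0 : ℕ) ∉ PA := fun h => Finset.disjoint_left.1 hAT h h0T
    have h0B : (0 : ℕ) ∉ PB := fun h => Finset.disjoint_left.1 hBT h h0T
    have hTd : T = insert 0 TI := by
      ext k; rw [memT, Finset.mem_insert]; simp only [h0T, hKT, and_true, and_false, false_or]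
    simp only [h0T, hKT, if_true, if_false]
    rw [hTd, orbit_insert h0TI, orbit_eq_sum_choose hK rA0 hB hTIi dA0 hBTI, orbit_eq_sum_choose hK hA rB0 hTIi hATI dB0,
      cmn _ _ iA0 rfl, cmn _ _ rfl iB0, iA0, iB0, hcA, hcB]
    by_cases hKA : K - 1 ∈ PA <;> by_cases hKB : K - 1 ∈ PB <;>
    · simp only [Gc, endSum, endTerms, List.map_cons, List.map_nil, List.sum_cons, List.sum_nil, add_zero, Finset.mem_insert,
        h0A, h0B, hKA, hKB, h0K, h0K.symm, true_or, or_true, or_false, false_or, decide_true, decide_false, if_true, if_false,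
        mul_add, Finset.sum_add_distrib]
  · -- end `K-1` split, end `0` decided
    have hKA : K - 1 ∉ PA := fun h => Finset.disjoint_left.1 hAT h hKT
    have hKB : K - 1 ∉ PB := fun h => Finset.disjoint_left.1 hBT h hKT
    have hTd : T = insert (K - 1) TI := by
      ext k; rw [memT, Finset.mem_insert]; simp only [h0T, hKT, and_true, and_false, false_or]
    simp only [h0T, hKT, if_true, if_false]
    rw [hTd, orbit_insert hKTI, orbit_eq_sum_choose hK rAK hB hTIi dAK hBTI, orbit_eq_sum_choose hK hA rBK hTIi hATI dBK,
      cmn _ _ iAK rfl, cmn _ _ rfl iBK, iAK, iBK, hcA, hcB]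
    by_cases h0A : 0 ∈ PA <;> by_cases h0B : 0 ∈ PB <;>
    · simp only [Gc, endSum, endTerms, List.map_cons, List.map_nil, List.sum_cons, List.sum_nil, add_zero, Finset.mem_insert,
        h0A, h0B, hKA, hKB, h0K, h0K.symm, true_or, or_true, or_false, false_or, decide_true, decide_false, if_true, if_false,
        mul_add, Finset.sum_add_distrib]
  · -- no split end
    have hTd : T = TI := by
      ext k; rw [memT]; simp only [h0T, hKT, and_false, false_or]
    simp only [h0T, hKT, if_false]
    rw [hTd, orbit_eq_sum_choose hK hA hB hTIi hATI hBTI, hcA, hcB]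
    by_cases h0A : 0 ∈ PA <;> by_cases h0B : 0 ∈ PB <;> by_cases hKA : K - 1 ∈ PA <;> by_cases hKB : K - 1 ∈ PB <;>
    · simp only [Gc, endSum, endTerms, List.map_cons, List.map_nil, List.sum_cons, List.sum_nil, add_zero, Finset.mem_insert,
        h0A, h0B, hKA, hKB, h0K, h0K.symm, true_or, or_true, or_false, false_or, decide_true, decide_false, if_true, if_false,
        mul_add, Finset.sum_add_distrib]

/-- The four interior statistics of an orbit count disjoint subsets of the interior: `c + p + q + s ≤ K − 2`. [this work] -/
theorem stats_le (hK : 4 ≤ K) {PA PB T : Finset ℕ} (hAT : Disjoint PA T) (hBT : Disjoint PB T) :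
    (PA ∩ PB ∩ inner K).card + ((PA \ PB) ∩ inner K).card + ((PB \ PA) ∩ inner K).card + (T ∩ inner K).card ≤ K - 2 := by
  classical
  rw [← card_inter_inner_split, ← card_inner (show 2 ≤ K by omega)]
  have h1 : Disjoint (PA ∩ inner K) ((PB \ PA) ∩ inner K) := by
    rw [Finset.disjoint_left]; intro k hk hk'
    rw [Finset.mem_inter] at hk; rw [Finset.mem_inter, Finset.mem_sdiff] at hk'; exact hk'.1.2 hk.1
  have h2 : Disjoint (PA ∩ inner K ∪ (PB \ PA) ∩ inner K) (T ∩ inner K) := by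
    rw [Finset.disjoint_left]; intro k hk hk'
    rw [Finset.mem_union, Finset.mem_inter, Finset.mem_inter, Finset.mem_sdiff] at hk; rw [Finset.mem_inter] at hk'
    rcases hk with ⟨h, -⟩ | ⟨⟨h, -⟩, -⟩
    · exact Finset.disjoint_left.1 hAT h hk'.1
    · exact Finset.disjoint_left.1 hBT h hk'.1
  rw [← Finset.card_union_of_disjoint h1, ← Finset.card_union_of_disjoint h2]
  exact Finset.card_le_card (Finset.union_subset (Finset.union_subset Finset.inter_subset_right Finset.inter_subset_right)
    Finset.inter_subset_right)

/-- **Every orbit sum with at least two interior split hairs is non-negative** (Pascal rule down to the level-2 positivity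
`TK.gc_two_nonneg`). [this work] -/
theorem orbit_nonneg_of_two_le (hK : 4 ≤ K) : ∀ (n : ℕ) (PA PB T : Finset ℕ), PA ⊆ range K → PB ⊆ range K → T ⊆ range K →
    Disjoint PA T → Disjoint PB T → (T ∩ inner K).card = n + 2 → 0 ≤ orbit K PA PB T := by
  classical
  intro n
  induction n with
  | zero =>
    intro PA PB T hA hB hT hAT hBT hs
    rw [orbit_eq_Gc hK hA hB hT hAT hBT, hs]
    exact gc_two_nonneg K _ _ _ _ _ (by have := stats_le hK hAT hBT; omega)
  | succ n ih =>
    intro PA PB T hA hB hT hAT hBT hs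
    -- pick an interior split hair and apply the Pascal rule
    obtain ⟨x, hx⟩ : (T ∩ inner K).Nonempty := by rw [← Finset.card_pos, hs]; omega
    rw [Finset.mem_inter] at hx
    have hxr : x ∈ range K := inner_subset_range hx.2
    have hTx : T = insert x (T.erase x) := (Finset.insert_erase hx.1).symm
    have hcard : (T.erase x ∩ inner K).card = n + 2 := by
      have : T.erase x ∩ inner K = (T ∩ inner K).erase x := by
        ext k; simp only [Finset.mem_inter, Finset.mem_erase]; tauto
      rw [this, Finset.card_erase_of_mem (Finset.mem_inter.2 hx), hs]; rfl
    have hE : T.erase x ⊆ range K := (Finset.erase_subset x T).trans hT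
    have hxA : x ∉ PA := fun h => Finset.disjoint_left.1 hAT h hx.1
    have hxB : x ∉ PB := fun h => Finset.disjoint_left.1 hBT h hx.1
    rw [hTx, orbit_insert (Finset.notMem_erase x T)]
    refine add_nonneg ?_ ?_
    · exact ih _ _ _ (Finset.insert_subset hxr hA) hB hE
        (Finset.disjoint_insert_left.2 ⟨Finset.notMem_erase x T, hAT.mono_right (Finset.erase_subset x T)⟩)
        (hBT.mono_right (Finset.erase_subset x T)) hcard
    · exact ih _ _ _ hA (Finset.insert_subset hxr hB) hE (hAT.mono_right (Finset.erase_subset x T))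
        (Finset.disjoint_insert_left.2 ⟨Finset.notMem_erase x T, hBT.mono_right (Finset.erase_subset x T)⟩) hcard

end TK

end Summit.CriticalPhenomena.PercolationContinuityZ3.Theorems.HairyCycle
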